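import Literature.Probability.RandomPlanarGeometry.SAWPivotDiameterLower
import HarnessLib

/-!
# The monotone walks form an isometric `(N-1)`-cube in the pivot graph of `S_N(ℤ²)`

Topic `Literature/Probability/RandomPlanarGeometry` (over `SAWPivotDiameterLower.lean`: the zigzag `zigzag P a b N`,
`statusDist`, `LatReach.statusDist_le`; and `SAWPivotDiagonal.lean`: `diagRefl`, `DiagStep`, `DiagReach`, `LatReach`).
Source: N. Madras, G. Slade, *The Self-Avoiding Walk* (Birkhäuser 1993), §9.4.3 (the pivot algorithm, p. 323; "the angle
between the `i`-th and `(i+1)`-th step of the walk can only change when `I = i`", p. 324; Corollary 9.4.5, p. 325).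

THIS FILE (`d = 2`; all PROVED; LANE COROLLARIES on the printed frame, not printed statements): fix orthogonal unit steps
`a, b`. The `2^{N-1}` monotone walks with steps in `{a, b}` and first step `a` are the zigzags `zigzag P a b N`
(`P` = the set of corner positions), all self-avoiding. A pivot at a site `t ≥ 1` of such a walk by the diagonal
reflection `σ` swapping `a ↔ b` yields the monotone walk whose corner set differs from `P` exactly at `t`
(`pivotAt_zigzag_diagRefl`). Hence two monotone walks with the same frame are joined by exactly as many diagonal pivots as
their status sequences differ (`diagReach_zigzag`), and by no shorter chain of pivots of any kind
(`LatReach.statusDist_le`): ★ `MadrasSlade1993_pivot_monotone_cube` — the pivot distance between them EQUALS the Hamming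
distance; the monotone walks with a fixed frame are an isometrically embedded `(N-1)`-dimensional hypercube.

## References
* N. Madras, G. Slade, *The Self-Avoiding Walk*, Birkhäuser (1993), §9.4.3 pp. 323–325.
-/

noncomputable section

open Finset Literature.Probability.LatticeModels Literature.Probability.Percolation SimpleGraph
open scoped BigOperators

namespace Literature.Probability.RandomPlanarGeometry.SAW.Zd.Pivot

variable {N : ℕ} {a b : Site 2}

/-! ### The swap reflection -/

/-- `σ_{-n} = σ_n`. [cite: MadrasSlade1993, §9.4.3 (p. 323); lane plumbing] -/
theorem diagRefl_neg (n w : Site 2) : diagRefl (-n) w = diagRefl n w := by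
  have h : dot2 w (-n) = - dot2 w n := by rw [dot2_comm, dot2_neg_left, dot2_comm]
  rw [diagRefl, diagRefl, h, smul_neg, neg_smul, neg_neg]

/-- For orthogonal unit steps, the diagonal reflection `σ_{a-b}` swaps `a` and `b`. [cite: MadrasSlade1993, §9.4.3 (p. 323: the two diagonal reflections); lane plumbing] -/
theorem diagRefl_sub_swap_left (ha : IsStep a) (hab : dot2 a b = 0) : diagRefl (a - b) a = b := by
  have h : dot2 b a = 0 := by rw [dot2_comm]; exact hab
  rw [show a - b = -(b - a) by abel, diagRefl_neg]
  exact ha.diagRefl_sub_self h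

/-- … and `b` to `a`. [cite: MadrasSlade1993, §9.4.3 (p. 323); lane plumbing] -/
theorem diagRefl_sub_swap_right (hb : IsStep b) (hab : dot2 a b = 0) : diagRefl (a - b) b = a :=
  hb.diagRefl_sub_self hab

/-! ### Zigzag bookkeeping -/

section ZZ

variable (P Q : ℕ → Prop) [DecidablePred P] [DecidablePred Q]

/-- Zigzags with corner sets agreeing below `i` have the same parity below `i`. [cite: MadrasSlade1993, §9.4.3 (p. 325); lane plumbing] -/
theorem zzPar_congr {i : ℕ} (h : ∀ s, 0 < s → s ≤ i → (P s ↔ Q s)) : zzPar P i = zzPar Q i := by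
  induction i with
  | zero => rfl
  | succ i ih =>
    simp only [zzPar]
    rw [ih (fun s hs0 hs => h s hs0 (by omega))]
    by_cases hP : P (i + 1)
    · rw [if_pos hP, if_pos ((h (i + 1) (Nat.succ_pos i) le_rfl).1 hP)]
    · rw [if_neg hP, if_neg (fun hQ => hP ((h (i + 1) (Nat.succ_pos i) le_rfl).2 hQ))]

/-- … and the same sites up to `i`. [cite: MadrasSlade1993, §9.4.3 (p. 325); lane plumbing] -/
theorem zzRaw_congr {i : ℕ} (h : ∀ s, 0 < s → s < i → (P s ↔ Q s)) : zzRaw P a b i = zzRaw Q a b i := by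
  induction i with
  | zero => rfl
  | succ i ih =>
    simp only [zzRaw]
    rw [ih (fun s hs0 hs => h s hs0 (by omega)), zzPar_congr P Q (fun s hs0 hs => h s hs0 (by omega))]

/-- If the corner sets differ exactly at `t`, the parities agree below `t` and are opposite from `t` on.
[cite: MadrasSlade1993, §9.4.3 (p. 325); lane plumbing] -/
theorem zzPar_toggle {t : ℕ} (ht : 0 < t) (h : ∀ s, s ≠ t → (P s ↔ Q s)) (hPQ : ¬ (P t ↔ Q t)) :
    ∀ i, t ≤ i → zzPar Q i = !(zzPar P i) := by
  intro i hi
  induction i with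
  | zero => omega
  | succ i ih =>
    rcases Nat.lt_or_ge i t with hlt | hge
    · -- `i + 1 = t`
      have hit : i + 1 = t := by omega
      have hpar : zzPar Q i = zzPar P i := zzPar_congr Q P (fun s _ hs => (h s (by omega)).symm)
      simp only [zzPar]
      rw [hpar, hit]
      by_cases hP : P t
      · have hQ : ¬ Q t := fun hQ => hPQ ⟨fun _ => hQ, fun _ => hP⟩
        simp [hP, hQ]
      · have hQ : Q t := by by_contra hQ; exact hPQ ⟨fun hp => absurd hp hP, fun hq => absurd hq hQ⟩
        simp [hP, hQ]
    · simp only [zzPar]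
      rw [ih hge]
      by_cases hP : P (i + 1)
      · rw [if_pos hP, if_pos ((h (i + 1) (by omega)).1 hP)]
      · rw [if_neg hP, if_neg (fun hQ => hP ((h (i + 1) (by omega)).2 hQ))]

end ZZ

/-! ### One diagonal pivot toggles one corner of a zigzag -/

/-- ★ **A pivot of a zigzag at a site `t ≥ 1` by the swap reflection is the zigzag with the corner at `t` toggled**
(`0 < t < N`): the head is unchanged, and beyond `t` every step `a` becomes `b` and conversely — which is exactly what
flipping the parity from `t` on does. [cite: MadrasSlade1993, §9.4.3 (p. 324: "the angle … can only change when
`I = i`"); lane corollary] -/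
theorem pivotAt_zigzag_diagRefl (P Q : ℕ → Prop) [DecidablePred P] [DecidablePred Q] (ha : IsStep a) (hb : IsStep b)
    (hab : dot2 a b = 0) {t : ℕ} (ht : 0 < t) (htN : t < N) (h : ∀ s, s ≠ t → (P s ↔ Q s)) (hPQ : ¬ (P t ↔ Q t)) :
    pivotAt (zigzag P a b N) t (diagRefl (a - b)) = zigzag Q a b N := by
  have hsa := diagRefl_sub_swap_left ha hab
  have hsb := diagRefl_sub_swap_right hb hab
  funext k
  rcases le_or_gt k t with hk | hk
  · -- head: untouched, and the two zigzags agree up to `t`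
    rw [pivotAt_of_le hk]
    simp only [zigzag, min_eq_left (show k ≤ N by omega)]
    exact zzRaw_congr P Q (fun s _ hs => h s (by omega))
  · rw [pivotAt_of_ge' (diagRefl_zero _) hk.le]
    -- both sides: position at `t` plus the (reflected) increments
    have key : ∀ m, t ≤ m → m ≤ N →
        zigzag P a b N t + diagRefl (a - b) (zigzag P a b N m - zigzag P a b N t) = zigzag Q a b N m := by
      intro m htm hmN
      induction m with
      | zero =>
        have : t = 0 := by omega
        omega
      | succ m ih =>
        rcases Nat.lt_or_ge m t with hlt | hge
        · have hmt : m + 1 = t := by omega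
          rw [hmt, sub_self, diagRefl_zero, add_zero]
          simp only [zigzag, min_eq_left htN.le]
          exact zzRaw_congr P Q (fun s _ hs => h s (by omega))
        · have ih' := ih hge (by omega)
          have e1 : zigzag P a b N (m + 1) = zigzag P a b N m + (if zzPar P m then b else a) := by
            simp only [zigzag, min_eq_left hmN, min_eq_left (show m ≤ N by omega), zzRaw]
          have e2 : zigzag Q a b N (m + 1) = zigzag Q a b N m + (if zzPar Q m then b else a) := by
            simp only [zigzag, min_eq_left hmN, min_eq_left (show m ≤ N by omega), zzRaw]
          rw [e1, show zigzag P a b N m + (if zzPar P m then b else a) - zigzag P a b N t =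
            (zigzag P a b N m - zigzag P a b N t) + (if zzPar P m then b else a) by abel,
            show ∀ x y : Site 2, diagRefl (a - b) (x + y) = diagRefl (a - b) x + diagRefl (a - b) y by
              intro x y; have := diagRefl_sub (a - b) (x + y) y; simp at this; rw [eq_sub_iff_add_eq] at this
              exact this.symm,
            ← add_assoc, ih', e2, zzPar_toggle P Q ht h hPQ m hge]
          cases zzPar P m <;> simp [hsa, hsb]
    rcases le_or_gt k N with hkN | hkN
    · exact key k hk.le hkN
    · -- frozen beyond `N`
      have eP : zigzag P a b N k = zigzag P a b N N := by simp [zigzag, min_eq_right hkN.le]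
      have eQ : zigzag Q a b N k = zigzag Q a b N N := by simp [zigzag, min_eq_right hkN.le]
      rw [eP, eQ]; exact key N htN.le le_rfl

/-- The toggled zigzag is one diagonal pivot away. [cite: MadrasSlade1993, §9.4.3 (p. 325: diagonal reflections); lane corollary] -/
theorem diagStep_zigzag_toggle (P Q : ℕ → Prop) [DecidablePred P] [DecidablePred Q] (ha : IsStep a) (hb : IsStep b)
    (hab : dot2 a b = 0) {t : ℕ} (ht : 0 < t) (htN : t < N) (h : ∀ s, s ≠ t → (P s ↔ Q s)) (hPQ : ¬ (P t ↔ Q t)) :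
    DiagStep N (zigzag P a b N) (zigzag Q a b N) :=
  ⟨zigzag_mem_saws ha hb hab N, zigzag_mem_saws ha hb hab N, t, a - b, htN, ha.isDiag_sub hb hab,
    (pivotAt_zigzag_diagRefl P Q ha hb hab ht htN h hPQ).symm⟩

/-! ### The cube -/

/-- The number of positions `0 < t < N` where two corner predicates differ. [cite: MadrasSlade1993, §9.4.3 (p. 324); lane definition] -/
def predDist (N : ℕ) (P Q : ℕ → Prop) [DecidablePred P] [DecidablePred Q] : ℕ :=
  ((range N).filter fun t => 0 < t ∧ ¬ (P t ↔ Q t)).card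

/-- The status distance of two zigzags is the number of positions where their corner sets differ (`a ≠ b`).
[cite: MadrasSlade1993, §9.4.3 (p. 324); lane plumbing] -/
theorem statusDist_zigzag (P Q : ℕ → Prop) [DecidablePred P] [DecidablePred Q] (hne : a ≠ b) :
    statusDist N (zigzag P a b N) (zigzag Q a b N) = predDist N P Q := by
  unfold statusDist predDist
  congr 1
  ext t
  simp only [mem_filter, mem_range]
  constructor
  · rintro ⟨ht, h0, hx⟩
    refine ⟨ht, h0, fun hpq => hx ?_⟩
    rw [straightAt_zigzag_iff hne h0 ht, straightAt_zigzag_iff hne h0 ht]; tauto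
  · rintro ⟨ht, h0, hx⟩
    refine ⟨ht, h0, fun hs => hx ?_⟩
    rw [straightAt_zigzag_iff hne h0 ht, straightAt_zigzag_iff hne h0 ht] at hs; tauto

/-- Upper bound: two zigzags of the same frame are joined by `predDist` diagonal pivots (toggle the differing positions
one at a time, staying monotone — hence self-avoiding — throughout). [cite: MadrasSlade1993, §9.4.3 (p. 325); lane corollary] -/
theorem diagReach_zigzag (ha : IsStep a) (hb : IsStep b) (hab : dot2 a b = 0) :
    ∀ (n : ℕ) (P Q : ℕ → Prop) [DecidablePred P] [DecidablePred Q], predDist N P Q = n →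
      DiagReach N (zigzag P a b N) (zigzag Q a b N) n := by
  classical
  intro n
  induction n with
  | zero =>
    intro P Q _ _ h0
    have hPQ : ∀ t, 0 < t → t < N → (P t ↔ Q t) := by
      intro t ht0 htN
      by_contra hx
      have : t ∈ (range N).filter fun t => 0 < t ∧ ¬ (P t ↔ Q t) := mem_filter.2 ⟨mem_range.2 htN, ht0, hx⟩
      rw [predDist, card_eq_zero] at h0
      rw [h0] at this; simp at this
    have : zigzag P a b N = zigzag Q a b N := by
      funext k
      simp only [zigzag]
      exact zzRaw_congr P Q (fun s hs0 hs => hPQ s hs0 (lt_of_lt_of_le hs (min_le_right k N)))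
    rw [this]; exact DiagReach.refl _
  | succ n ih =>
    intro P Q _ _ hd
    -- pick a differing position `t`, toggle it in `P`
    have hne : ((range N).filter fun t => 0 < t ∧ ¬ (P t ↔ Q t)).Nonempty := by
      rw [← card_pos]; unfold predDist at hd; omega
    obtain ⟨t, ht⟩ := hne
    rw [mem_filter, mem_range] at ht
    obtain ⟨htN, ht0, hx⟩ := ht
    let P' : ℕ → Prop := fun s => if s = t then Q t else P s
    haveI : DecidablePred P' := fun s => by unfold P'; infer_instance
    have hstep : DiagStep N (zigzag P a b N) (zigzag P' a b N) := by
      refine diagStep_zigzag_toggle P P' ha hb hab ht0 htN (fun s hs => ?_) ?_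
      · simp [P', hs]
      · simp only [P', if_true]; exact hx
    have hd' : predDist N P' Q = n := by
      unfold predDist at hd ⊢
      have : ((range N).filter fun s => 0 < s ∧ ¬ (P' s ↔ Q s)) =
          ((range N).filter fun s => 0 < s ∧ ¬ (P s ↔ Q s)).erase t := by
        ext s
        simp only [mem_filter, mem_range, mem_erase, P']
        by_cases hs : s = t
        · subst hs; simp
        · simp [hs]
      rw [this, card_erase_of_mem (mem_filter.2 ⟨mem_range.2 htN, ht0, hx⟩), hd]; rfl
    exact DiagReach.head hstep (ih P' Q hd')

/-- ★★ **The monotone walks with a fixed frame form an isometric `(N-1)`-cube in the pivot graph of `S_N(ℤ²)`**: for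
orthogonal unit steps `a ≠ b` and corner predicates `P, Q`, the zigzags `zigzag P a b N`, `zigzag Q a b N` (monotone,
first step `a`) are joined by exactly `predDist N P Q` diagonal-reflection pivots, and by no chain of fewer pivots of
the original algorithm (all eight symmetries). [cite: MadrasSlade1993, §9.4.3 (pp. 323–325: the pivot algorithm and its
diagonal-reflection variant); lane corollary, not printed] -/
theorem MadrasSlade1993_pivot_monotone_cube (ha : IsStep a) (hb : IsStep b) (hab : dot2 a b = 0)
    (P Q : ℕ → Prop) [DecidablePred P] [DecidablePred Q] :
    DiagReach N (zigzag P a b N) (zigzag Q a b N) (predDist N P Q) ∧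
      ∀ k, LatReach N (zigzag P a b N) (zigzag Q a b N) k → predDist N P Q ≤ k := by
  have hne : a ≠ b := by
    intro h; rw [h, hb.dot2_self] at hab; exact one_ne_zero hab
  refine ⟨diagReach_zigzag ha hb hab _ P Q rfl, fun k hk => ?_⟩
  have := hk.statusDist_le
  rw [statusDist_zigzag P Q hne] at this
  omega

end Literature.Probability.RandomPlanarGeometry.SAW.Zd.Pivot
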